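import Literature.Computability.MetaComplexity.EFChainSem
import HarnessLib
import Literature.Barriers.PneNP.FeasibleInterpolationProofs

/-!
# Assembly of the RSA-pair tautologies, I: occurrences as extension lists, the disjunction gadget, unweakening

Base layer of the final assembly (the `EF`-proofs of the disjointness of the RSA pair,
`Literature.Barriers.PneNP.RSAPairDisjointnessEFProofs`). Occurrences of templates are placed
freely — an `Occ` is a base variable and an input map — and contribute their gate definitions
as *extension lists* (`FregeSystem.IsExtList`, `EFScaffold.lean`), either to the constraint sets
`T₀, T₁` of the tautology or to the refutation's own abbreviations `E`:

* `FregeSystem.IsExtList.append` — concatenation of well-allocated extension lists;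
* `Netlist.Occ.edefs`, `Occ.isExtList_edefs`, `Occ.avail_of_forall_mem` — the definitions of an
  occurrence, their allocation, and availability of the occurrence from the availability of its
  definition lines under the context;
* `Netlist.orT m` — the gadget `⋁_{1 ≤ i < m} nᵢ` ("`n ≥ 2`") with its well-formedness and
  semantics;
* `RSA.rUnweak` — the sound rule `K ∨ (c ∨ ¬a), K ∨ a ⊢ K ∨ c` removing the escape literal of the
  weakened constraints of `T₀`, and `RSA.unweaken`.

## Sources

* S. A. Cook, R. A. Reckhow, *The relative efficiency of propositional proof systems*,
  J. Symbolic Logic 44 (1979), §2, Def. 4.1.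
* J. Krajíček, P. Pudlák, *Some consequences of cryptographical conjectures for `S¹₂` and `EF`*,
  Inform. and Comput. 140 (1998), Thm. 1, Cor. 10.
-/

namespace Literature.Computability.MetaComplexity

open _root_.Computability Complexity Complexity.PropForm FregeSystem Netlist

/-! ### Extension lists -/

/-- **Concatenation of well-allocated extension lists**: if `E₁` is well allocated above `b`, `E₂`
above `b₂ ≥ b`, and every variable of `E₁` is below `b₂`, then `E₁ ++ E₂` is well allocated above `b`.
[cite: CookReckhow1979, Def. 4.1] -/
theorem FregeSystem.IsExtList.append {b b₂ : ℕ} {E₁ E₂ : List (ℕ × PropForm ℕ)} (h₁ : FregeSystem.IsExtList b E₁) (h₂ : FregeSystem.IsExtList b₂ E₂)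
    (hb : b ≤ b₂) (h12 : ∀ e ∈ E₁, e.1 < b₂) : FregeSystem.IsExtList b (E₁ ++ E₂) := by
  refine ⟨fun e he => ?_, ?_, fun e he => ?_⟩
  · rcases List.mem_append.1 he with he | he
    exacts [h₁.1 e he, hb.trans (h₂.1 e he)]
  · rw [List.pairwise_append]
    exact ⟨h₁.2.1, h₂.2.1, fun e he e' he' => (h12 e he).trans_le (h₂.1 e' he')⟩
  · rcases List.mem_append.1 he with he | he
    exacts [h₁.2.2 e he, h₂.2.2 e he]

/-- The empty extension list is well allocated. [folklore] -/
theorem FregeSystem.IsExtList.nil (b : ℕ) : FregeSystem.IsExtList b [] := ⟨fun _ h => by simp at h, List.Pairwise.nil, fun _ h => by simp at h⟩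

/-- Every variable of a well-allocated list below a bound `B` stays below `B`. [folklore] -/
theorem FregeSystem.IsExtList.lt_of_forall {b : ℕ} {E : List (ℕ × PropForm ℕ)} (_h : FregeSystem.IsExtList b E) {B : ℕ} (hB : ∀ e ∈ E, e.1 < B) :
    ∀ e ∈ E, e.1 < B := hB

namespace Netlist

/-! ### Occurrences as extension lists -/

/-- The gate definitions of an occurrence as extension pairs `(gate variable, body)`. [folklore] -/
def Occ.edefs (o : Occ) (t : Template) (nIn : ℕ) : List (ℕ × PropForm ℕ) := (o.inst nIn).defs t

/-- Length of the definitions. [folklore] -/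
@[simp] theorem Occ.length_edefs (o : Occ) (t : Template) (nIn : ℕ) : (o.edefs t nIn).length = t.length := Inst.length_defs _ _

/-- The variables of the definitions are the gates `base … base + |t| - 1`. [folklore] -/
theorem Occ.fst_mem_edefs {o : Occ} {t : Template} {nIn : ℕ} {e : ℕ × PropForm ℕ} (he : e ∈ o.edefs t nIn) :
    o.base ≤ e.1 ∧ e.1 < o.base + t.length := by
  obtain ⟨k, hk, rfl⟩ := ((o.inst nIn).mem_defs_iff t).1 he
  simp only [Inst.wire, Occ.base_inst]
  omega

/-- **The definitions of an occurrence of a well-formed template whose inputs lie below its base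
are well allocated** above any `b ≤ base`. [cite: CookReckhow1979, Def. 4.1] -/
theorem Occ.isExtList_edefs (o : Occ) {t : Template} {nIn b : ℕ} (hwf : t.WF nIn) (hin : ∀ i < nIn, o.inp i < o.base) (hb : b ≤ o.base) :
    FregeSystem.IsExtList b (o.edefs t nIn) :=
  (o.inst nIn).isExtList_defs hwf (fun i hi => by rw [o.getD_inst hi]; exact hin i hi) hb

/-- **Availability of an occurrence from its definition lines**: if every line `K ∨ (g ↔ body)` of
the occurrence is in `Γ`, the occurrence is available. [folklore] -/
theorem Occ.avail_of_forall_mem {o : Occ} {t : Template} {nIn : ℕ} {K : PropForm ℕ} {Γ : Set (PropForm ℕ)}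
    (h : ∀ e ∈ o.edefs t nIn, ctx K (biimp (var e.1) e.2) ∈ Γ) : o.Avail t nIn K Γ :=
  fun _ hk => h _ ((o.inst nIn).wire_body_mem_defs t hk)

/-- The sizes of the bodies of the definitions of a well-formed template are bounded (`≤ 25`).
[folklore] -/
theorem Occ.size_of_mem_edefs {o : Occ} {t : Template} {nIn : ℕ} {e : ℕ × PropForm ℕ} (he : e ∈ o.edefs t nIn) : e.2.size ≤ 25 := by
  obtain ⟨k, hk, rfl⟩ := ((o.inst nIn).mem_defs_iff t).1 he
  simp only [Inst.body]
  set l := (t[k]).args.map fun a => var ((o.inst nIn).ref a) with hl'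
  have harg : ∀ i, (arg l i).size ≤ 1 := by
    intro i
    unfold arg
    rw [List.getD_eq_getElem?_getD]
    cases h : l[i]? with
    | none => simp [size]
    | some a =>
      obtain ⟨r, -, rfl⟩ := List.mem_map.1 (List.mem_of_getElem? h)
      simp [size]
  have h0 := harg 0; have h1 := harg 1; have h2 := harg 2
  cases (t[k]).kind <;> simp only [Kind.body, xor3F, majF, muxF, size, FregeSystem.size_biimp] <;> omega

/-! ### The gadget `⋁_{1 ≤ i < m} nᵢ` -/

/-- The template computing `⋁_{1 ≤ i < m} nᵢ` on `m` inputs: wire `0` is `⊥`, wire `j+1` is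
`wire j ∨ n_{j+1}` (`j + 1 < m`); the output is wire `m - 1` (wire `0` if `m ≤ 1`). [folklore] -/
def orT (m : ℕ) : Template := ⟨Kind.cst false, []⟩ :: (List.range (m - 1)).map fun j => ⟨Kind.or, [Sum.inr j, Sum.inl (j + 1)]⟩

/-- Length of the gadget. [folklore] -/
@[simp] theorem length_orT (m : ℕ) : (orT m).length = m - 1 + 1 := by simp [orT]

/-- The first gate. [folklore] -/
theorem orT_zero (m : ℕ) (h : 0 < (orT m).length) : (orT m)[0] = ⟨Kind.cst false, []⟩ := by simp [orT]

/-- The `or` gates. [folklore] -/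
theorem orT_succ (m : ℕ) {j : ℕ} (_hj : j < m - 1) (h : j + 1 < (orT m).length) : (orT m)[j + 1] = ⟨Kind.or, [Sum.inr j, Sum.inl (j + 1)]⟩ := by
  simp [orT]

/-- **The gadget is well formed** (`m` inputs). [cite: Vollmer1999, Def. 1.6] -/
theorem wf_orT (m : ℕ) : (orT m).WF m := by
  intro k hk
  rcases k with _ | j
  · rw [orT_zero]; exact ⟨rfl, fun a ha => by simp at ha⟩
  · have hj : j < m - 1 := by simp at hk; omega
    rw [orT_succ m hj]
    refine ⟨rfl, fun a ha => ?_⟩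
    simp only [List.mem_cons, List.not_mem_nil, or_false] at ha
    rcases ha with rfl | rfl
    · exact ⟨fun i hi => (by cases hi), fun j' hj' => (by cases hj'; omega)⟩
    · exact ⟨fun i hi => (by cases hi; omega), fun j' hj' => (by cases hj')⟩

/-- The Boolean `⋁_{1 ≤ i ≤ j} nᵢ`. [folklore] -/
def orUpTo (inp : ℕ → Bool) (j : ℕ) : Bool := (List.range (j + 1)).any fun i => decide (1 ≤ i) && inp i

/-- One more position of the disjunction. [folklore] -/
theorem orUpTo_succ (inp : ℕ → Bool) (j : ℕ) : orUpTo inp (j + 1) = (orUpTo inp j || inp (j + 1)) := by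
  have h1 : decide (1 ≤ j + 1) = true := decide_eq_true (by omega)
  rw [orUpTo, List.range_succ, List.any_append, List.any_cons, List.any_nil, Bool.or_false, h1, Bool.true_and]
  rfl

/-- **Semantics of the gadget**: wire `j` carries `⋁_{1 ≤ i ≤ j} nᵢ` (`j ≤ m - 1`). [folklore] -/
theorem wireVal_orT (m : ℕ) (inp : ℕ → Bool) : ∀ {j : ℕ}, j ≤ m - 1 → wireVal (orT m) inp j = orUpTo inp j
  | 0, _ => by
    rw [wireVal_eq (wf_orT m) inp (by simp), orT_zero]
    simp [Kind.fn, orUpTo]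
  | j + 1, hj => by
    rw [wireVal_eq (wf_orT m) inp (by simp; omega), orT_succ m (by omega)]
    simp only [Kind.fn, argVal, List.getElem?_cons_zero, List.getElem?_cons_succ, refVal]
    rw [wireVal_orT m inp (j := j) (by omega), orUpTo_succ]

/-- The disjunction is true iff some bit at a position `≥ 1` below `j + 1` is set. [folklore] -/
theorem orUpTo_eq_true_iff (inp : ℕ → Bool) (j : ℕ) : orUpTo inp j = true ↔ ∃ i, 1 ≤ i ∧ i ≤ j ∧ inp i = true := by
  simp only [orUpTo, List.any_eq_true, List.mem_range, Bool.and_eq_true, decide_eq_true_eq]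
  constructor
  · rintro ⟨i, hi, hi1, hb⟩; exact ⟨i, hi1, by omega, hb⟩
  · rintro ⟨i, hi1, hij, hb⟩; exact ⟨i, by omega, hi1, hb⟩

/-- A set bit at position `i` gives a word `≥ 2^i`. [folklore] -/
theorem pow_le_wval {inp : ℕ → Bool} {i : ℕ} (hi : inp i = true) : ∀ {W : ℕ}, i < W → 2 ^ i ≤ wval inp W
  | 0, h => absurd h (Nat.not_lt_zero i)
  | W + 1, hiW => by
    rw [wval_succ]
    rcases Nat.lt_succ_iff_lt_or_eq.1 hiW with hiW' | rfl
    · exact (pow_le_wval hi hiW').trans (Nat.le_add_right _ _)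
    · rw [hi]; simp

/-- A word whose bits at positions `≥ 1` are false carries at most `1`. [folklore] -/
theorem wval_le_one {inp : ℕ → Bool} (h : ∀ i, 1 ≤ i → inp i = false) : ∀ W, wval inp W ≤ 1
  | 0 => by simp
  | W + 1 => by
    rw [wval_succ]
    rcases Nat.eq_zero_or_pos W with rfl | hW0
    · simp; exact toNat_le_one _
    · rw [h W hW0]; simp; exact wval_le_one h W

/-- The output of the gadget is `[n ≥ 2]` for the number `n` carried by its `m` inputs. [folklore] -/
theorem wireVal_orT_out (m : ℕ) (inp : ℕ → Bool) : wireVal (orT m) inp (m - 1) = decide (2 ≤ wval inp m) := by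
  rw [wireVal_orT m inp le_rfl]
  rcases Bool.eq_false_or_eq_true (orUpTo inp (m - 1)) with h | h <;> rw [h] <;> symm
  · obtain ⟨i, hi1, him, hi⟩ := (orUpTo_eq_true_iff inp (m - 1)).1 h
    rw [decide_eq_true_iff]
    have h2 : 2 ≤ 2 ^ i := by
      calc 2 = 2 ^ 1 := rfl
        _ ≤ 2 ^ i := Nat.pow_le_pow_right (by norm_num) hi1
    exact h2.trans (pow_le_wval hi (by omega))
  · rw [decide_eq_false_iff_not]
    have hall : ∀ i, 1 ≤ i → i < m → inp i = false := fun i hi him => by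
      by_contra hb
      have hb' : inp i = true := by simpa using hb
      have := (orUpTo_eq_true_iff inp (m - 1)).2 ⟨i, hi, by omega, hb'⟩
      rw [h] at this; cases this
    have : wval inp m = wval (fun i => if i < m then inp i else false) m := wval_congr fun i hi => by rw [if_pos hi]
    rw [this]
    have hle := wval_le_one (inp := fun i => if i < m then inp i else false) (fun i hi => by
      by_cases him : i < m
      · rw [if_pos him]; exact hall i hi him
      · rw [if_neg him]) m
    omega

end Netlist

/-! ### Unweakening the constraints of `T₀` -/

namespace RSA

/-- **Unit resolution on the escape literal**: `K ∨ (c ∨ ¬a), K ∨ a ⊢ K ∨ c`.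
[cite: CookReckhow1979, §2 (sound rule)] -/
def rUnweak : FregeRule := ⟨[ctx (var 0) (disj (var 1) (neg (var 2))), ctx (var 0) (var 2)], ctx (var 0) (var 1)⟩

/-- The rules of the assembly. [cite: CookReckhow1979, §2] -/
def rules : List FregeRule := [rUnweak]

/-- Every rule of the assembly is sound. [cite: CookReckhow1979, §2 (sound rule)] -/
theorem isSound_of_mem_rules : ∀ r ∈ rules, r.IsSound := by
  intro r hr
  simp only [rules, List.mem_cons, List.not_mem_nil, or_false] at hr
  subst hr
  exact FregeRule.isSound_of_check (by decide +kernel)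

variable {G : FregeSystem} {K : PropForm ℕ} {Γ : Set (PropForm ℕ)}

/-- **Unweakening**: from the weakened lines `K ∨ (c ∨ ¬a)` (`c ∈ Ls`) and `K ∨ a`, the lines
`K ∨ c`. [cite: CookReckhow1979, §2] -/
theorem unweaken (hG : ∀ r ∈ rules, r ∈ G.rules) {a : ℕ} {Ls : List (PropForm ℕ)} (hLs : ∀ c ∈ Ls, ctx K (disj c (neg (var a))) ∈ Γ)
    (ha : ctx K (var a) ∈ Γ) {b : ℕ} (hb : ∀ c ∈ Ls, c.size ≤ b) : G.Yields Γ (ctxSet K Ls) (Ls.length * (K.size + b + 1)) := by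
  induction Ls with
  | nil => exact Yields.of_subset G (by simp [ctxSet]) _
  | cons c Ls ih =>
    have h1 : G.Yields Γ {ctx K c} (K.size + b + 1) := by
      have h := Yields.single (FregeSystem.IsInferredFrom.of_rule (hG rUnweak (by simp [rules])) (S := Γ) (FregeSystem.sub [K, c, var a]) (θ := ctx K c) rfl
        (FregeSystem.prems_cons (hLs c (by simp)) (FregeSystem.prems_cons ha FregeSystem.prems_nil)))
      refine h.mono_size ?_
      have := hb c (by simp)
      simp [ctx, size]; omega
    have h2 := ih (fun c' hc' => hLs c' (by simp [hc'])) fun c' hc' => hb c' (by simp [hc'])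
    have h := h1.union h2
    refine (h.mono_right ?_).mono_size (by simp [Nat.succ_mul]; ring_nf; omega)
    rintro θ ⟨L, hL, rfl⟩
    rcases List.mem_cons.1 hL with rfl | hL
    · exact Or.inl rfl
    · exact Or.inr (mem_ctxSet hL)

end RSA

end Literature.Computability.MetaComplexity

/-!
# Assembly of the RSA-pair tautologies, II: the two constraint sets

The constraint sets `T₀`, `T₁` of the tautology `¬⋀T₀ ∨ ¬⋀T₁` expressing the disjointness of
the RSA pair (Krajíček–Pudlák 1998, Thm. 1) at bit length `m`, generic in an operation kit `k`
on `W`-bit words (intended: modular multiplication). Copy `c ∈ {0, 1}` owns a private block of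
variables starting at `P`: the witness exponent bits `u`, a zero gate `z`, the gadget
`o = ⋁_{1≤i<m} nᵢ` (`EFAssemblySem.lean`), and the occurrences

  `Y = one' ∘ y` (`one' = (o, z, …, z)`, so `res Y = y mod n`),  `A = CH(res Y, e)`,
  `Z = CH(res A, u)`,  `X = CH(res Y, u)`,

(`CH` the chain of `EFChain.lean`, i.e. exponentiation), copy `1` also the comparators of the zero
word, of `one'` and of `res Y` with `n`. The common atoms are the bits of `n, e, y`
(`0 … 3m-1`); words are padded by `z` from position `m` on. The constraints: the gate
definitions, the certificate `res Z = res Y` (i.e. `y^(e·u) ≡ y`), the parity literal of bit `0`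
of `res X` (`= y^u mod n`, the witness `x` of the pair), and for copy `1` the literals `o`
(`n ≥ 2`) and the three comparison facts; the constraints of copy `0` other than the gadget's
definitions are weakened by `∨ ¬o` (escape for `n ≤ 1`).

This file: the occurrences and lists (`RSA.T0`, `RSA.T1`), their variables
(`RSA.vars_T0`, `RSA.vars_T1`: private blocks are disjoint from each other, common variables
are atoms `< 3m`) and sizes.

## Sources

* J. Krajíček, P. Pudlák, *Some consequences of cryptographical conjectures for `S¹₂` and `EF`*,
  Inform. and Comput. 140 (1998), Thm. 1 and its proof, Cor. 10.
* S. A. Cook, R. A. Reckhow, *The relative efficiency of propositional proof systems*,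
  J. Symbolic Logic 44 (1979), Def. 4.1.
-/

namespace Literature.Computability.MetaComplexity

open _root_.Computability Complexity Complexity.PropForm FregeSystem Netlist ModAdd

namespace RSA

variable {W : ℕ} (k : ModAdd.OpKit W) (m P : ℕ)

/-! ### The words of a copy -/

/-- The zero gate of the copy. [folklore] -/
def zv : ℕ := P + m
/-- The gadget output `o = ⋁_{1≤i<m} nᵢ`. [folklore] -/
def ov : ℕ := P + m + 1 + (m - 1)
/-- The modulus word (atoms, padded by `z`). [folklore] -/
def nw (i : ℕ) : ℕ := if i < m then i else zv m P
/-- The exponent word. [folklore] -/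
def ew (i : ℕ) : ℕ := if i < m then m + i else zv m P
/-- The base word. [folklore] -/
def yw (i : ℕ) : ℕ := if i < m then 2 * m + i else zv m P
/-- The witness word. [folklore] -/
def uw (i : ℕ) : ℕ := if i < m then P + i else zv m P
/-- The word `one' = (o, z, …, z)` ("`1 mod n`"). [folklore] -/
def onew (i : ℕ) : ℕ := if i = 0 then ov m P else zv m P

/-- Three-operand input map from three words. [folklore] -/
def inp3 (x y n : ℕ → ℕ) (q : ℕ) : ℕ := if q < W then x q else if q < 2 * W then y (q - W) else n (q - 2 * W)

/-- First operand of a three-operand input map. [folklore] -/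
theorem inp3_x {x y n : ℕ → ℕ} {i : ℕ} (hi : i < W) : inp3 (W := W) x y n i = x i := by simp [inp3, hi]
/-- Second operand. [folklore] -/
theorem inp3_y (x y n : ℕ → ℕ) (i : ℕ) (hi : i < W) : inp3 (W := W) x y n (W + i) = y i := by
  unfold inp3; rw [if_neg (by omega), if_pos (by omega), Nat.add_sub_cancel_left]
/-- Third operand. [folklore] -/
theorem inp3_n (x y n : ℕ → ℕ) (i : ℕ) : inp3 (W := W) x y n (2 * W + i) = n i := by
  unfold inp3; rw [if_neg (by omega), if_neg (by omega), Nat.add_sub_cancel_left]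

/-! ### The occurrences of a copy -/

/-- The zero gate as an occurrence of a one-gate template. [folklore] -/
def ZO : Occ := ⟨zv m P, fun _ => 0⟩
/-- The gadget. [folklore] -/
def ORo : Occ := ⟨P + m + 1, fun i => i⟩
/-- Base of `Y`. [folklore] -/
def bY : ℕ := P + m + 1 + (m - 1 + 1)
/-- `Y = one' ∘ y`. [folklore] -/
def Yo : Occ := ⟨bY m P, inp3 (W := W) (onew m P) (yw m P) (nw m P)⟩
/-- Base of `A`. [folklore] -/
def bA : ℕ := bY m P + k.T.length
/-- `A = CH(res Y, e)`. [folklore] -/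
def Ao : Occ := ⟨bA k m P, inp3 (W := W) (k.res (Yo (W := W) m P)) (ew m P) (nw m P)⟩
/-- Base of `Z`. [folklore] -/
def bZ : ℕ := bA k m P + k.chainT.length
/-- `Z = CH(res A, u)`. [folklore] -/
def Zo : Occ := ⟨bZ k m P, inp3 (W := W) (k.t (Ao k m P) W) (uw m P) (nw m P)⟩
/-- Base of `X`. [folklore] -/
def bX : ℕ := bZ k m P + k.chainT.length
/-- `X = CH(res Y, u)`. [folklore] -/
def Xo : Occ := ⟨bX k m P, inp3 (W := W) (k.res (Yo (W := W) m P)) (uw m P) (nw m P)⟩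
/-- Base of the comparators. [folklore] -/
def bC : ℕ := bX k m P + k.chainT.length
/-- Two-operand input map. [folklore] -/
def inp2 (x n : ℕ → ℕ) (q : ℕ) : ℕ := if q < W then x q else n (q - W)
/-- The comparator of the zero word with `n`. [folklore] -/
def C0 : Occ := ⟨bC k m P, inp2 (W := W) (fun _ => zv m P) (nw m P)⟩
/-- The comparator of `one'` with `n`. [folklore] -/
def C1 : Occ := ⟨bC k m P + (3 * W + 1), inp2 (W := W) (onew m P) (nw m P)⟩
/-- The comparator of `res Y` with `n`. [folklore] -/
def CY : Occ := ⟨bC k m P + 2 * (3 * W + 1), inp2 (W := W) (k.res (Yo (W := W) m P)) (nw m P)⟩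
/-- The end of the private block. [folklore] -/
def bEnd : ℕ := bC k m P + 3 * (3 * W + 1)

/-- The comparator views. [folklore] -/
def VC0 : Sub.View := ⟨bC k m P, fun _ => zv m P, nw m P⟩
/-- The comparator views. [folklore] -/
def VC1 : Sub.View := ⟨bC k m P + (3 * W + 1), onew m P, nw m P⟩
/-- The comparator views. [folklore] -/
def VCY : Sub.View := ⟨bC k m P + 2 * (3 * W + 1), k.res (Yo (W := W) m P), nw m P⟩

/-! ### The constraint lists -/

/-- The definitions of the computing occurrences of a copy (without the gadget). [folklore] -/
def compDefs : List (ℕ × PropForm ℕ) :=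
  (ZO m P).edefs (constRow (fun _ => false) 1) 0 ++ (Yo (W := W) m P).edefs k.T (3 * W) ++ (Ao k m P).edefs k.chainT (3 * W) ++
    (Zo k m P).edefs k.chainT (3 * W) ++ (Xo k m P).edefs k.chainT (3 * W)

/-- The definitions of the comparators (copy `1`). [folklore] -/
def cmpDefs : List (ℕ × PropForm ℕ) :=
  (C0 k m P).edefs (Sub.subT W) (2 * W) ++ (C1 k m P).edefs (Sub.subT W) (2 * W) ++ (CY k m P).edefs (Sub.subT W) (2 * W)

/-- The certificate `res Z = res Y`. [folklore] -/
def certZ : List (PropForm ℕ) := eqW (k.t (Zo k m P) W) (k.res (Yo (W := W) m P)) W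

/-- **The constraints of copy `0`**: the gadget's definitions, then — weakened by `∨ ¬o` — the
other definitions, the certificate and the parity literal `¬(res X)₀`.
[cite: KrajicekPudlak1998, Thm. 1] -/
def T0 : List (PropForm ℕ) :=
  extAxioms ((ORo m P).edefs (orT m) m) ++
    (extAxioms (compDefs k m P) ++ certZ k m P ++ [neg (var (k.t (Xo k m P) W 0))]).map fun c => disj c (neg (var (ov m P)))

/-- **The constraints of copy `1`**: all definitions, the certificate, the parity literal `(res X)₀`,
the literal `o` (`n ≥ 2`) and the comparison facts `0 < n`, `one' < n`, `res Y < n`.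
[cite: KrajicekPudlak1998, Thm. 1] -/
def T1 : List (PropForm ℕ) :=
  extAxioms ((ORo m P).edefs (orT m) m ++ compDefs k m P ++ cmpDefs k m P) ++ certZ k m P ++
    [var (k.t (Xo k m P) W 0), var (ov m P), neg (var ((VC0 k m P).ge W W)), neg (var ((VC1 k m P).ge W W)), neg (var ((VCY k m P).ge W W))]

end RSA

end Literature.Computability.MetaComplexity

/-!
# Assembly of the RSA-pair tautologies, III: the constraint sets are satisfiable on the members of the pair

For a triple `(n, e, y)` in `Aᶜ` of the RSA pair (`Literature.Barriers.PneNP.rsaPair c`) with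
`n, e, y < 2^m`, the constraints `T_c` (`EFAssemblySem.lean`) are satisfied by the canonical
assignment: the common atoms carry the bits of `n, e, y` (`AssignsTriple`), the private witness
word carries an exponent `u < n` with `y^(e·u) ≡ y` and `y^u ≡ x (mod n)` (from the witnesses
`x, d, r` of membership: an inverse of `e` modulo `r` when `r ≥ 2`, `u = 0` when `r = 1`,
`u = d` when `r = 0`; Krajíček–Pudlák's computation `rsaPair_decode`), and every gate carries its
wire value. The certificate `res Z = res Y` then says `y^(eu) mod n = y mod n`, the parity
literal reads bit `0` of `y^u mod n = x`, and for copy `1` (where `n ≥ 2` as `x` is odd) the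
gadget and comparison literals hold. Requires an operation kit computing modular multiplication
(`OpKit.Computes`) with unit pattern `1`.

## Sources

* J. Krajíček, P. Pudlák, *Some consequences of cryptographical conjectures for `S¹₂` and `EF`*,
  Inform. and Comput. 140 (1998), Thm. 1 and its proof (preprint pp. 3–4).
-/

namespace Literature.Computability.MetaComplexity

open _root_.Computability Complexity Complexity.PropForm FregeSystem Netlist ModAdd
open Literature.Barriers.PneNP (rsaPair mem_rsaPair_iff rsaPair_decode AssignsTriple)

namespace RSA

/-! ### The witness exponent -/

/-- **The witness exponent of a member of the pair**: `u < n` with `y^(e·u) ≡ y` and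
`y^u ≡ x (mod n)` of parity `c`. [cite: KrajicekPudlak1998, proof of Thm. 1] -/
theorem exists_witness {c n e y : ℕ} (h : (n, e, y) ∈ rsaPair c) :
    ∃ u x : ℕ, u < n ∧ x < n ∧ x % 2 = c ∧ y ^ (e * u) ≡ y [MOD n] ∧ y ^ u ≡ x [MOD n] := by
  rw [mem_rsaPair_iff] at h
  obtain ⟨x, d, r, hx, hd, hr, hpar, he, hyd, hyr, hcop⟩ := h
  rcases Nat.lt_or_ge r 2 with hr2 | hr2
  · interval_cases r
    · -- `r = 0`: `e = 1`, take `u = d`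
      have he1 : e = 1 := by have h := hcop; rwa [Nat.Coprime, Nat.gcd_zero_right] at h
      subst he1
      refine ⟨d, x, hd, hx, hpar, ?_, hyd⟩
      rw [one_mul]
      calc y ^ d ≡ x [MOD n] := hyd
        _ = x ^ 1 := (pow_one x).symm
        _ ≡ y [MOD n] := he
    · -- `r = 1`: `y ≡ 1`, `x ≡ 1`, take `u = 0`
      refine ⟨0, x, by omega, hx, hpar, ?_, ?_⟩
      · rw [Nat.mul_zero, pow_zero]; exact (pow_one y ▸ hyr).symm
      · rw [pow_zero]
        calc 1 = 1 ^ d := (one_pow d).symm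
          _ ≡ (y ^ 1) ^ d [MOD n] := (hyr.pow d).symm
          _ = y ^ d := by rw [pow_one]
          _ ≡ x [MOD n] := hyd
  · obtain ⟨u, hur, hu⟩ := Nat.exists_mul_mod_eq_one_of_coprime hcop hr2
    have hdecomp : e * u = r * (e * u / r) + 1 := by
      have := Nat.div_add_mod (e * u) r
      rw [hu] at this
      exact this.symm
    refine ⟨u, x, by omega, hx, hpar, ?_, rsaPair_decode he hyd hyr hdecomp⟩
    set q := e * u / r with hq
    calc y ^ (e * u) = (y ^ r) ^ q * y := by rw [hdecomp, pow_succ, pow_mul]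
      _ ≡ 1 ^ q * y [MOD n] := (hyr.pow _).mul_right y
      _ = y := by rw [one_pow, one_mul]

/-- A member of the pair has a positive modulus. [folklore] -/
theorem pos_of_mem {c n e y : ℕ} (h : (n, e, y) ∈ rsaPair c) : 0 < n := by
  rw [mem_rsaPair_iff] at h; obtain ⟨x, -, -, hx, -⟩ := h; omega

/-- A member of `A¹` has modulus `≥ 2` (its witness `x` is odd). [folklore] -/
theorem two_le_of_mem_one {n e y : ℕ} (h : (n, e, y) ∈ rsaPair 1) : 2 ≤ n := by
  rw [mem_rsaPair_iff] at h; obtain ⟨x, -, -, hx, -, -, hpar, -⟩ := h; omega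

/-! ### The value words -/

variable {W : ℕ} (k : ModAdd.OpKit W) (m P : ℕ)

/-- The bits of a number `< 2^m` as a padded word. [folklore] -/
def nwB (a : ℕ) (i : ℕ) : Bool := if i < m then a.testBit i else false
/-- The word `one' = ([n ≥ 2], 0, …, 0)`. [folklore] -/
def owB (n : ℕ) (i : ℕ) : Bool := if i = 0 then decide (2 ≤ n) else false
/-- Three-operand input values. [folklore] -/
def inp3B (x y z : ℕ → Bool) (q : ℕ) : Bool := if q < W then x q else if q < 2 * W then y (q - W) else z (q - 2 * W)
/-- Two-operand input values. [folklore] -/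
def inp2B (x z : ℕ → Bool) (q : ℕ) : Bool := if q < W then x q else z (q - W)
/-- The values of the result of `Y = one' ∘ y`. [folklore] -/
def yB (n y : ℕ) (i : ℕ) : Bool := wireVal k.T (inp3B (W := W) (owB n) (nwB m y) (nwB m n)) (k.resOff i)
/-- The values of the gates of `A = CH(res Y, e)`. [folklore] -/
def aG (n e y : ℕ) (g : ℕ) : Bool := wireVal k.chainT (inp3B (W := W) (yB k m n y) (nwB m e) (nwB m n)) g
/-- The values of the gates of `Z = CH(res A, u)`. [folklore] -/
def zG (n e y u : ℕ) (g : ℕ) : Bool := wireVal k.chainT (inp3B (W := W) (fun i => aG k m n e y (k.tOff W i)) (nwB m u) (nwB m n)) g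
/-- The values of the gates of `X = CH(res Y, u)`. [folklore] -/
def xG (n y u : ℕ) (g : ℕ) : Bool := wireVal k.chainT (inp3B (W := W) (yB k m n y) (nwB m u) (nwB m n)) g

/-- **The canonical assignment** of copy `c` at private base `P` for the member `(n, e, y)` with
witness exponent `u`. [folklore] -/
def assign (n e y u : ℕ) (v : ℕ) : Bool :=
  if v < m then n.testBit v else if v < 2 * m then e.testBit (v - m) else if v < 3 * m then y.testBit (v - 2 * m)
  else if v < P then false
  else if v < P + m then u.testBit (v - P)
  else if v < P + m + 1 then false
  else if v < bY m P then wireVal (orT m) (fun i => n.testBit i) (v - (P + m + 1))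
  else if v < bA k m P then wireVal k.T (inp3B (W := W) (owB n) (nwB m y) (nwB m n)) (v - bY m P)
  else if v < bZ k m P then aG k m n e y (v - bA k m P)
  else if v < bX k m P then zG k m n e y u (v - bZ k m P)
  else if v < bC k m P then xG k m n y u (v - bX k m P)
  else if v < bC k m P + (3 * W + 1) then wireVal (Sub.subT W) (inp2B (W := W) (fun _ => false) (nwB m n)) (v - bC k m P)
  else if v < bC k m P + 2 * (3 * W + 1) then wireVal (Sub.subT W) (inp2B (W := W) (owB n) (nwB m n)) (v - (bC k m P + (3 * W + 1)))
  else if v < bEnd k m P then wireVal (Sub.subT W) (inp2B (W := W) (yB k m n y) (nwB m n)) (v - (bC k m P + 2 * (3 * W + 1)))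
  else false

/-! ### Satisfaction of an occurrence from the values of its wires -/

/-- **An occurrence is satisfied by an assignment carrying its wire values**: if `σ` gives the
inputs of `o` the values `vin` and its gates the wire values of the template on `vin` (inputs
below the base), then `σ` satisfies all gate definitions of `o`. [cite: CookReckhow1979, Def. 4.1] -/
theorem _root_.Literature.Computability.MetaComplexity.Netlist.Occ.sat_of_values {o : Occ} {t : Template} {nIn : ℕ} (hwf : t.WF nIn)
    {σ vin : ℕ → Bool} (hvin : ∀ i < nIn, σ (o.inp i) = vin i) (hgate : ∀ g < t.length, σ (o.base + g) = wireVal t vin g)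
    (hin : ∀ i < nIn, o.inp i < o.base) : (o.inst nIn).Sat t σ := by
  have hin' : ∀ i < nIn, (o.inst nIn).inputs.getD i 0 < (o.inst nIn).base := fun i hi => by rw [o.getD_inst hi]; exact hin i hi
  have hs := (o.inst nIn).sat_assign hwf hin' σ
  have heq : (o.inst nIn).assign t σ = σ := by
    funext v
    by_cases hv : (o.inst nIn).base ≤ v ∧ v < (o.inst nIn).base + t.length
    · obtain ⟨g, hg, rfl⟩ : ∃ g, g < t.length ∧ v = o.base + g := ⟨v - o.base, by simp at hv; omega, by simp at hv; omega⟩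
      have h1 : (o.inst nIn).assign t σ ((o.inst nIn).wire g) = wireVal t (fun i => σ ((o.inst nIn).inputs.getD i 0)) g := (o.inst nIn).assign_wire t σ hg
      have h2 : σ (o.base + g) = wireVal t vin g := hgate g hg
      show (o.inst nIn).assign t σ ((o.inst nIn).wire g) = σ (o.base + g)
      rw [h1, h2]
      exact wireVal_congr hwf (fun i hi => by rw [o.getD_inst hi, hvin i hi]) hg
    · exact (o.inst nIn).assign_of_not_mem t σ hv
  rw [heq] at hs; exact hs

/-- The definition lines of a satisfied occurrence are true. [cite: CookReckhow1979, Def. 4.1] -/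
theorem eval_of_mem_extAxioms_edefs {o : Occ} {t : Template} {nIn : ℕ} {σ : ℕ → Bool} (h : (o.inst nIn).Sat t σ) :
    ∀ c ∈ extAxioms (o.edefs t nIn), c.eval σ = true := by
  intro c hc
  obtain ⟨e, he, rfl⟩ := List.mem_map.1 hc
  obtain ⟨g, hg, rfl⟩ := ((o.inst nIn).mem_defs_iff t).1 he
  exact h.eval_biimp hg

/-! ### Reading the canonical assignment -/

section Reading

variable {k m P} {n e y u : ℕ}

/-- Unfolding the bases (for `omega`). [folklore] -/
theorem bases : zv m P = P + m ∧ ov m P = P + m + 1 + (m - 1) ∧ bY m P = P + m + 1 + (m - 1 + 1) ∧ bA k m P = bY m P + k.T.length ∧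
    bZ k m P = bA k m P + k.chainT.length ∧ bX k m P = bZ k m P + k.chainT.length ∧ bC k m P = bX k m P + k.chainT.length ∧
    bEnd k m P = bC k m P + 3 * (3 * W + 1) := ⟨rfl, rfl, rfl, rfl, rfl, rfl, rfl, rfl⟩

/-- The atoms of `n`. [folklore] -/
theorem assign_n {v : ℕ} (hv : v < m) : assign k m P n e y u v = n.testBit v := by unfold assign; rw [if_pos hv]

/-- The atoms of `e`. [folklore] -/
theorem assign_e {i : ℕ} (hi : i < m) : assign k m P n e y u (m + i) = e.testBit i := by
  unfold assign; rw [if_neg (by omega), if_pos (by omega), Nat.add_sub_cancel_left]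

/-- The atoms of `y`. [folklore] -/
theorem assign_y {i : ℕ} (hi : i < m) : assign k m P n e y u (2 * m + i) = y.testBit i := by
  unfold assign; rw [if_neg (by omega), if_neg (by omega), if_pos (by omega), Nat.add_sub_cancel_left]

/-- The witness bits. [folklore] -/
theorem assign_u (hP : 3 * m ≤ P) {i : ℕ} (hi : i < m) : assign k m P n e y u (P + i) = u.testBit i := by
  unfold assign; rw [if_neg (by omega), if_neg (by omega), if_neg (by omega), if_neg (by omega), if_pos (by omega), Nat.add_sub_cancel_left]

/-- The zero gate. [folklore] -/
theorem assign_zv (hP : 3 * m ≤ P) : assign k m P n e y u (zv m P) = false := by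
  unfold assign zv; rw [if_neg (by omega), if_neg (by omega), if_neg (by omega), if_neg (by omega), if_neg (by omega), if_pos (by omega)]

/-- The gadget's gates. [folklore] -/
theorem assign_or (hP : 3 * m ≤ P) {g : ℕ} (hg : g < m - 1 + 1) : assign k m P n e y u (P + m + 1 + g) = wireVal (orT m) (fun i => n.testBit i) g := by
  unfold assign bY
  rw [if_neg (by omega), if_neg (by omega), if_neg (by omega), if_neg (by omega), if_neg (by omega), if_neg (by omega), if_pos (by omega), Nat.add_sub_cancel_left]

/-- The gates of `Y`. [folklore] -/
theorem assign_Y (hP : 3 * m ≤ P) {g : ℕ} (hg : g < k.T.length) : assign k m P n e y u (bY m P + g) = wireVal k.T (inp3B (W := W) (owB n) (nwB m y) (nwB m n)) g := by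
  have hb := bases (k := k) (m := m) (P := P) (W := W)
  unfold assign
  rw [if_neg (by omega), if_neg (by omega), if_neg (by omega), if_neg (by omega), if_neg (by omega), if_neg (by omega), if_neg (by omega), if_pos (by omega),
    Nat.add_sub_cancel_left]

/-- The gates of `A`. [folklore] -/
theorem assign_A (hP : 3 * m ≤ P) {g : ℕ} (hg : g < k.chainT.length) : assign k m P n e y u (bA k m P + g) = aG k m n e y g := by
  have hb := bases (k := k) (m := m) (P := P) (W := W)
  unfold assign
  rw [if_neg (by omega), if_neg (by omega), if_neg (by omega), if_neg (by omega), if_neg (by omega), if_neg (by omega), if_neg (by omega), if_neg (by omega),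
    if_pos (by omega), Nat.add_sub_cancel_left]

/-- The gates of `Z`. [folklore] -/
theorem assign_Z (hP : 3 * m ≤ P) {g : ℕ} (hg : g < k.chainT.length) : assign k m P n e y u (bZ k m P + g) = zG k m n e y u g := by
  have hb := bases (k := k) (m := m) (P := P) (W := W)
  unfold assign
  rw [if_neg (by omega), if_neg (by omega), if_neg (by omega), if_neg (by omega), if_neg (by omega), if_neg (by omega), if_neg (by omega), if_neg (by omega),
    if_neg (by omega), if_pos (by omega), Nat.add_sub_cancel_left]

/-- The gates of `X`. [folklore] -/
theorem assign_X (hP : 3 * m ≤ P) {g : ℕ} (hg : g < k.chainT.length) : assign k m P n e y u (bX k m P + g) = xG k m n y u g := by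
  have hb := bases (k := k) (m := m) (P := P) (W := W)
  unfold assign
  rw [if_neg (by omega), if_neg (by omega), if_neg (by omega), if_neg (by omega), if_neg (by omega), if_neg (by omega), if_neg (by omega), if_neg (by omega),
    if_neg (by omega), if_neg (by omega), if_pos (by omega), Nat.add_sub_cancel_left]

/-- The gates of the comparator `C0`. [folklore] -/
theorem assign_C0 (hP : 3 * m ≤ P) {g : ℕ} (hg : g < 3 * W + 1) : assign k m P n e y u (bC k m P + g) = wireVal (Sub.subT W) (inp2B (W := W) (fun _ => false) (nwB m n)) g := by
  have hb := bases (k := k) (m := m) (P := P) (W := W)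
  unfold assign
  rw [if_neg (by omega), if_neg (by omega), if_neg (by omega), if_neg (by omega), if_neg (by omega), if_neg (by omega), if_neg (by omega), if_neg (by omega),
    if_neg (by omega), if_neg (by omega), if_neg (by omega), if_pos (by omega), Nat.add_sub_cancel_left]

/-- The gates of the comparator `C1`. [folklore] -/
theorem assign_C1 (hP : 3 * m ≤ P) {g : ℕ} (hg : g < 3 * W + 1) : assign k m P n e y u (bC k m P + (3 * W + 1) + g) = wireVal (Sub.subT W) (inp2B (W := W) (owB n) (nwB m n)) g := by
  have hb := bases (k := k) (m := m) (P := P) (W := W)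
  unfold assign
  rw [if_neg (by omega), if_neg (by omega), if_neg (by omega), if_neg (by omega), if_neg (by omega), if_neg (by omega), if_neg (by omega), if_neg (by omega),
    if_neg (by omega), if_neg (by omega), if_neg (by omega), if_neg (by omega), if_pos (by omega), Nat.add_sub_cancel_left]

/-- The gates of the comparator `CY`. [folklore] -/
theorem assign_CY (hP : 3 * m ≤ P) {g : ℕ} (hg : g < 3 * W + 1) :
    assign k m P n e y u (bC k m P + 2 * (3 * W + 1) + g) = wireVal (Sub.subT W) (inp2B (W := W) (yB k m n y) (nwB m n)) g := by
  have hb := bases (k := k) (m := m) (P := P) (W := W)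
  unfold assign
  rw [if_neg (by omega), if_neg (by omega), if_neg (by omega), if_neg (by omega), if_neg (by omega), if_neg (by omega), if_neg (by omega), if_neg (by omega),
    if_neg (by omega), if_neg (by omega), if_neg (by omega), if_neg (by omega), if_neg (by omega), if_pos (by omega), Nat.add_sub_cancel_left]

/-- The words read by the occurrences. [folklore] -/
theorem assign_nw (hP : 3 * m ≤ P) (i : ℕ) : assign k m P n e y u (nw m P i) = nwB m n i := by
  unfold nw nwB; split_ifs with h
  · exact assign_n h
  · exact assign_zv hP

/-- The words read by the occurrences. [folklore] -/
theorem assign_ew (hP : 3 * m ≤ P) (i : ℕ) : assign k m P n e y u (ew m P i) = nwB m e i := by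
  unfold ew nwB; split_ifs with h
  · exact assign_e h
  · exact assign_zv hP

/-- The words read by the occurrences. [folklore] -/
theorem assign_yw (hP : 3 * m ≤ P) (i : ℕ) : assign k m P n e y u (yw m P i) = nwB m y i := by
  unfold yw nwB; split_ifs with h
  · exact assign_y h
  · exact assign_zv hP

/-- The words read by the occurrences. [folklore] -/
theorem assign_uw (hP : 3 * m ≤ P) (i : ℕ) : assign k m P n e y u (uw m P i) = nwB m u i := by
  unfold uw nwB; split_ifs with h
  · exact assign_u hP h
  · exact assign_zv hP

/-- The gadget output (for `n < 2^m`). [folklore] -/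
theorem assign_ov (hP : 3 * m ≤ P) (hn : n < 2 ^ m) : assign k m P n e y u (ov m P) = decide (2 ≤ n) := by
  rw [ov, assign_or hP (by omega), wireVal_orT_out, wval_testBit_of_lt hn]

/-- The word `one'`. [folklore] -/
theorem assign_onew (hP : 3 * m ≤ P) (hn : n < 2 ^ m) (i : ℕ) : assign k m P n e y u (onew m P i) = owB n i := by
  unfold onew owB; split_ifs with h
  · exact assign_ov hP hn
  · exact assign_zv hP

/-- Three-operand inputs read the three value words. [folklore] -/
theorem assign_inp3 {x yy z : ℕ → ℕ} {xB yyB zB : ℕ → Bool} (hx : ∀ i < W, assign k m P n e y u (x i) = xB i) (hy : ∀ i < W, assign k m P n e y u (yy i) = yyB i)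
    (hz : ∀ i < W, assign k m P n e y u (z i) = zB i) {q : ℕ} (hq : q < 3 * W) :
    assign k m P n e y u (inp3 (W := W) x yy z q) = inp3B (W := W) xB yyB zB q := by
  unfold inp3 inp3B; split_ifs with h1 h2
  · exact hx q h1
  · exact hy _ (by omega)
  · exact hz _ (by omega)

/-- Two-operand inputs read the two value words. [folklore] -/
theorem assign_inp2 {x z : ℕ → ℕ} {xB zB : ℕ → Bool} (hx : ∀ i < W, assign k m P n e y u (x i) = xB i) (hz : ∀ i < W, assign k m P n e y u (z i) = zB i)
    {q : ℕ} (hq : q < 2 * W) : assign k m P n e y u (inp2 (W := W) x z q) = inp2B (W := W) xB zB q := by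
  unfold inp2 inp2B; split_ifs with h1
  · exact hx q h1
  · exact hz _ (by omega)

/-- The result of `Y`. [folklore] -/
theorem assign_resY (hP : 3 * m ≤ P) (i : ℕ) (hi : i < W) : assign k m P n e y u (k.res (Yo (W := W) m P) i) = yB k m n y i := by
  show assign k m P n e y u (bY m P + k.resOff i) = _; rw [assign_Y hP (k.resOff_lt i hi)]; rfl

/-- The result of `A`. [folklore] -/
theorem assign_tA (hP : 3 * m ≤ P) (i : ℕ) (hi : i < W) : assign k m P n e y u (k.t (Ao k m P) W i) = aG k m n e y (k.tOff W i) := by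
  rw [k.t_eq]; exact assign_A hP (k.tOff_lt le_rfl hi)

/-- The result of `Z`. [folklore] -/
theorem assign_tZ (hP : 3 * m ≤ P) (i : ℕ) (hi : i < W) : assign k m P n e y u (k.t (Zo k m P) W i) = zG k m n e y u (k.tOff W i) := by
  rw [k.t_eq]; exact assign_Z hP (k.tOff_lt le_rfl hi)

/-- The result of `X`. [folklore] -/
theorem assign_tX (hP : 3 * m ≤ P) (i : ℕ) (hi : i < W) : assign k m P n e y u (k.t (Xo k m P) W i) = xG k m n y u (k.tOff W i) := by
  rw [k.t_eq]; exact assign_X hP (k.tOff_lt le_rfl hi)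

/-- A number `≥ 2` below `2^m` forces `m > 0`. [folklore] -/
theorem pos_of_two_le {n m : ℕ} (h2 : 2 ≤ n) (hn : n < 2 ^ m) : 0 < m :=
  Nat.pos_of_ne_zero (by rintro rfl; simp at hn; omega)

end Reading

/-! ### The occurrences are satisfied -/

section Sat

variable {k m P} {n e y u : ℕ} (hP : 3 * m ≤ P) (hn : n < 2 ^ m)
include hP

/-- The zero gate is satisfied. [folklore] -/
theorem sat_ZO : ((ZO m P).inst 0).Sat (constRow (fun _ => false) 1) (assign k m P n e y u) :=
  Occ.sat_of_values (vin := fun _ => false) (wf_constRow _ _ 0) (fun i hi => absurd hi (Nat.not_lt_zero i)) (fun g hg => by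
    have hg0 : g = 0 := by simpa using hg
    subst hg0
    rw [Nat.add_zero, show (ZO m P).base = zv m P from rfl, assign_zv hP, wireVal_eq (wf_constRow _ _ 0) _ (by simp), getElem_constRow]; rfl)
    fun i hi => absurd hi (Nat.not_lt_zero i)

/-- The gadget is satisfied. [folklore] -/
theorem sat_ORo : ((ORo m P).inst m).Sat (orT m) (assign k m P n e y u) :=
  Occ.sat_of_values (vin := fun i => n.testBit i) (wf_orT m) (fun i hi => assign_n hi) (fun g hg => assign_or hP (by simpa using hg))
    fun i hi => by show i < P + m + 1; omega

include hn in
/-- `Y` is satisfied. [folklore] -/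
theorem sat_Yo : ((Yo (W := W) m P).inst (3 * W)).Sat k.T (assign k m P n e y u) :=
  Occ.sat_of_values k.wf (fun i hi => assign_inp3 (fun i _ => assign_onew hP hn i) (fun i _ => assign_yw hP i) (fun i _ => assign_nw hP i) hi)
    (fun g hg => assign_Y hP hg) fun i hi => by
    have hb := bases (k := k) (m := m) (P := P) (W := W)
    show inp3 (W := W) (onew m P) (yw m P) (nw m P) i < bY m P
    unfold inp3 onew yw nw zv ov; split_ifs <;> omega

/-- `A` is satisfied. [folklore] -/
theorem sat_Ao : ((Ao k m P).inst (3 * W)).Sat k.chainT (assign k m P n e y u) := by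
  refine Occ.sat_of_values k.wf_chainT (vin := inp3B (W := W) (yB k m n y) (nwB m e) (nwB m n))
    (fun i hi => assign_inp3 (fun i hi => assign_resY hP i hi) (fun i _ => assign_ew hP i) (fun i _ => assign_nw hP i) hi)
    (fun g hg => assign_A hP hg) fun i hi => ?_
  · have hb := bases (k := k) (m := m) (P := P) (W := W)
    show inp3 (W := W) (k.res (Yo (W := W) m P)) (ew m P) (nw m P) i < bA k m P
    unfold inp3 ew nw zv; split_ifs with h1 h2 h3
    · have := k.resOff_lt i h1; show bY m P + k.resOff i < _; omega
    all_goals omega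

/-- `Z` is satisfied. [folklore] -/
theorem sat_Zo : ((Zo k m P).inst (3 * W)).Sat k.chainT (assign k m P n e y u) := by
  refine Occ.sat_of_values k.wf_chainT (vin := inp3B (W := W) (fun i => aG k m n e y (k.tOff W i)) (nwB m u) (nwB m n))
    (fun i hi => assign_inp3 (fun i hi => assign_tA hP i hi) (fun i _ => assign_uw hP i) (fun i _ => assign_nw hP i) hi)
    (fun g hg => assign_Z hP hg) fun i hi => ?_
  have hb := bases (k := k) (m := m) (P := P) (W := W)
  show inp3 (W := W) (k.t (Ao k m P) W) (uw m P) (nw m P) i < bZ k m P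
  unfold inp3 uw nw zv; split_ifs with h1 h2 h3
  · have := k.tOff_lt (le_refl W) h1; rw [k.t_eq]; show bA k m P + k.tOff W i < _; omega
  all_goals omega

/-- `X` is satisfied. [folklore] -/
theorem sat_Xo : ((Xo k m P).inst (3 * W)).Sat k.chainT (assign k m P n e y u) := by
  refine Occ.sat_of_values k.wf_chainT (vin := inp3B (W := W) (yB k m n y) (nwB m u) (nwB m n))
    (fun i hi => assign_inp3 (fun i hi => assign_resY hP i hi) (fun i _ => assign_uw hP i) (fun i _ => assign_nw hP i) hi)
    (fun g hg => assign_X hP hg) fun i hi => ?_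
  have hb := bases (k := k) (m := m) (P := P) (W := W)
  show inp3 (W := W) (k.res (Yo (W := W) m P)) (uw m P) (nw m P) i < bX k m P
  unfold inp3 uw nw zv; split_ifs with h1 h2 h3
  · have := k.resOff_lt i h1; show bY m P + k.resOff i < _; omega
  all_goals omega

/-- The comparator `C0` is satisfied. [folklore] -/
theorem sat_C0 : ((C0 k m P).inst (2 * W)).Sat (Sub.subT W) (assign k m P n e y u) := by
  refine Occ.sat_of_values (Sub.wf_subT W) (vin := inp2B (W := W) (fun _ => false) (nwB m n))
    (fun i hi => assign_inp2 (fun i _ => assign_zv hP) (fun i _ => assign_nw hP i) hi) (fun g hg => assign_C0 hP (by simpa using hg)) fun i hi => ?_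
  have hb := bases (k := k) (m := m) (P := P) (W := W)
  show inp2 (W := W) (fun _ => zv m P) (nw m P) i < bC k m P
  unfold inp2 nw zv; split_ifs <;> (try simp only []) <;> omega

include hn in
/-- The comparator `C1` is satisfied. [folklore] -/
theorem sat_C1 : ((C1 k m P).inst (2 * W)).Sat (Sub.subT W) (assign k m P n e y u) := by
  refine Occ.sat_of_values (Sub.wf_subT W) (vin := inp2B (W := W) (owB n) (nwB m n))
    (fun i hi => assign_inp2 (fun i _ => assign_onew hP hn i) (fun i _ => assign_nw hP i) hi) (fun g hg => assign_C1 hP (by simpa using hg)) fun i hi => ?_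
  have hb := bases (k := k) (m := m) (P := P) (W := W)
  show inp2 (W := W) (onew m P) (nw m P) i < bC k m P + (3 * W + 1)
  unfold inp2 onew nw zv ov; split_ifs <;> omega

/-- The comparator `CY` is satisfied. [folklore] -/
theorem sat_CY : ((CY k m P).inst (2 * W)).Sat (Sub.subT W) (assign k m P n e y u) := by
  refine Occ.sat_of_values (Sub.wf_subT W) (vin := inp2B (W := W) (yB k m n y) (nwB m n))
    (fun i hi => assign_inp2 (fun i hi => assign_resY hP i hi) (fun i _ => assign_nw hP i) hi) (fun g hg => assign_CY hP (by simpa using hg)) fun i hi => ?_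
  have hb := bases (k := k) (m := m) (P := P) (W := W)
  show inp2 (W := W) (k.res (Yo (W := W) m P)) (nw m P) i < bC k m P + 2 * (3 * W + 1)
  unfold inp2 nw zv; split_ifs with h1 h2
  · have := k.resOff_lt i h1; show bY m P + k.resOff i < _; omega
  all_goals omega

end Sat

/-! ### The values of the words -/

section Values

variable {k m} {n e y u : ℕ}

/-- A padded word carries its number. [folklore] -/
theorem wval_nwB {a : ℕ} (ha : a < 2 ^ m) (hmW : m ≤ W) : wval (nwB m a) W = a := by
  have h : wval (nwB m a) W = wval (fun i => a.testBit i) W := wval_congr fun i _ => by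
    unfold nwB; split_ifs with h
    · rfl
    · exact (Nat.testBit_eq_false_of_lt (ha.trans_le (Nat.pow_le_pow_right (by norm_num) (not_lt.1 h)))).symm
  rw [h, wval_testBit_of_lt (ha.trans_le (Nat.pow_le_pow_right (by norm_num) hmW))]

/-- The word `one'` carries `[n ≥ 2]`. [folklore] -/
theorem wval_owB (hW : 0 < W) : wval (owB n) W = (decide (2 ≤ n)).toNat := by
  by_cases h2 : 2 ≤ n
  · rw [decide_eq_true h2]; exact wval_onehot hW fun i _ => by unfold owB; rw [decide_eq_true h2]; by_cases hi : i = 0 <;> simp [hi]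
  · rw [decide_eq_false h2]; exact wval_eq_zero fun i _ => by unfold owB; rw [decide_eq_false h2]; split_ifs <;> rfl

/-- Projections of three-operand input values. [folklore] -/
theorem wval_inp3B_x (x yy z : ℕ → Bool) : wval (fun i => inp3B (W := W) x yy z i) W = wval x W := wval_congr fun i hi => by simp [inp3B, hi]
/-- Projections of three-operand input values. [folklore] -/
theorem wval_inp3B_y (x yy z : ℕ → Bool) : wval (fun i => inp3B (W := W) x yy z (W + i)) W = wval yy W :=
  wval_congr fun i hi => by unfold inp3B; rw [if_neg (by omega), if_pos (by omega), Nat.add_sub_cancel_left]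
/-- Projections of three-operand input values. [folklore] -/
theorem wval_inp3B_n (x yy z : ℕ → Bool) : wval (fun i => inp3B (W := W) x yy z (2 * W + i)) W = wval z W :=
  wval_congr fun i _ => by unfold inp3B; rw [if_neg (by omega), if_neg (by omega), Nat.add_sub_cancel_left]
/-- Projections of two-operand input values. [folklore] -/
theorem wval_inp2B_x (x z : ℕ → Bool) : wval (fun i => inp2B (W := W) x z i) W = wval x W := wval_congr fun i hi => by simp [inp2B, hi]
/-- Projections of two-operand input values. [folklore] -/
theorem wval_inp2B_n (x z : ℕ → Bool) : wval (fun i => inp2B (W := W) x z (W + i)) W = wval z W :=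
  wval_congr fun i _ => by unfold inp2B; rw [if_neg (by omega), Nat.add_sub_cancel_left]

variable {NOK : ℕ → Prop} (hT : k.Computes NOK fun x y N => x * y % N) (hNOK : NOK n) (hn : n < 2 ^ m) (hmW : m ≤ W) (hW : 0 < W)
include hT hNOK hn hmW hW

/-- **`res Y` carries `y mod n`** (for `n ≥ 1`). [folklore] -/
theorem wval_yB (hn1 : 1 ≤ n) (hy : y < 2 ^ m) : wval (yB k m n y) W = y % n := by
  have h := hT (inp3B (W := W) (owB n) (nwB m y) (nwB m n))
  rw [wval_inp3B_x, wval_inp3B_y, wval_inp3B_n, wval_nwB hn hmW, wval_nwB hy hmW, wval_owB hW] at h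
  have hlt : (decide (2 ≤ n)).toNat < n := by by_cases h2 : 2 ≤ n <;> simp [h2] <;> omega
  have hdef : yB k m n y = fun i => wireVal k.T (inp3B (W := W) (owB n) (nwB m y) (nwB m n)) (k.resOff i) := rfl
  rw [hdef, h hNOK hlt]
  by_cases h2 : 2 ≤ n
  · simp [h2]
  · have hn1' : n = 1 := by omega
    subst hn1'; simp [Nat.mod_one]

variable (he1 : ∀ i < W, k.e i = decide (i = 0)) (h2 : 2 ≤ n) (hy : y < 2 ^ m)
include he1 h2 hy

/-- **`res A` carries `(y mod n)^e mod n`** (for `n ≥ 2`). [folklore] -/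
theorem wval_aG (he : e < 2 ^ m) : wval (fun i => aG k m n e y (k.tOff W i)) W = (y % n) ^ e % n := by
  have hyB := wval_yB hT hNOK hn hmW hW (by omega) hy
  have h := k.powChain_eq hT he1 (inp3B (W := W) (yB k m n y) (nwB m e) (nwB m n))
  rw [wval_inp3B_x, wval_inp3B_y, wval_inp3B_n, wval_nwB hn hmW, wval_nwB he hmW, hyB] at h
  exact h hNOK (by omega) (Nat.mod_lt _ (by omega))

/-- **`res Z` carries `y^(e·u) mod n`**. [folklore] -/
theorem wval_zG (he : e < 2 ^ m) (hu : u < 2 ^ m) : wval (fun i => zG k m n e y u (k.tOff W i)) W = y ^ (e * u) % n := by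
  have haG := wval_aG hT hNOK hn hmW hW he1 h2 hy he
  have h := k.powChain_eq hT he1 (inp3B (W := W) (fun i => aG k m n e y (k.tOff W i)) (nwB m u) (nwB m n))
  rw [wval_inp3B_x, wval_inp3B_y, wval_inp3B_n, wval_nwB hn hmW, wval_nwB hu hmW, haG] at h
  have h' := h hNOK (by omega) (Nat.mod_lt _ (by omega))
  rw [← Nat.pow_mod, ← pow_mul, ← Nat.pow_mod] at h'
  exact h'

omit he1 h2 in
/-- **`res X` carries `y^u mod n`**. [folklore] -/
theorem wval_xG (he1 : ∀ i < W, k.e i = decide (i = 0)) (h2 : 2 ≤ n) (hu : u < 2 ^ m) : wval (fun i => xG k m n y u (k.tOff W i)) W = y ^ u % n := by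
  have hyB := wval_yB hT hNOK hn hmW hW (by omega) hy
  have h := k.powChain_eq hT he1 (inp3B (W := W) (yB k m n y) (nwB m u) (nwB m n))
  rw [wval_inp3B_x, wval_inp3B_y, wval_inp3B_n, wval_nwB hn hmW, wval_nwB hu hmW, hyB] at h
  have h' := h hNOK (by omega) (Nat.mod_lt _ (by omega))
  rw [← Nat.pow_mod] at h'
  exact h'

end Values

/-! ### The constraint sets hold on the members of the pair -/

section Sem

variable {k m P} {NOK : ℕ → Prop} (hT : k.Computes NOK fun x y N => x * y % N) (hNOKall : ∀ n, 0 < n → n < 2 ^ m → NOK n)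
  (he1 : ∀ i < W, k.e i = decide (i = 0)) (hmW : m ≤ W) (hP : 3 * m ≤ P)
include hP

omit hP in
/-- The canonical assignment assigns the atoms. [folklore] -/
theorem assignsTriple (n e y u : ℕ) : AssignsTriple m n e y (assign k m P n e y u) := fun _ hi => ⟨assign_n hi, assign_e hi, assign_y hi⟩

/-- The definitions of the computing occurrences hold. [folklore] -/
theorem eval_compDefs {n e y u : ℕ} (hn : n < 2 ^ m) : ∀ c ∈ extAxioms (compDefs k m P), c.eval (assign k m P n e y u) = true := by
  intro c hc
  obtain ⟨d, hd, rfl⟩ := List.mem_map.1 hc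
  simp only [compDefs, List.mem_append] at hd
  rcases hd with (((hd | hd) | hd) | hd) | hd
  · exact eval_of_mem_extAxioms_edefs (sat_ZO (k := k) (e := e) (y := y) (u := u) (n := n) hP) _ (List.mem_map_of_mem hd)
  · exact eval_of_mem_extAxioms_edefs (sat_Yo (k := k) (e := e) (u := u) hP hn) _ (List.mem_map_of_mem hd)
  · exact eval_of_mem_extAxioms_edefs (sat_Ao (k := k) (u := u) hP) _ (List.mem_map_of_mem hd)
  · exact eval_of_mem_extAxioms_edefs (sat_Zo (k := k) hP) _ (List.mem_map_of_mem hd)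
  · exact eval_of_mem_extAxioms_edefs (sat_Xo (k := k) (e := e) hP) _ (List.mem_map_of_mem hd)

/-- The definitions of the comparators hold. [folklore] -/
theorem eval_cmpDefs {n e y u : ℕ} (hn : n < 2 ^ m) : ∀ c ∈ extAxioms (cmpDefs k m P), c.eval (assign k m P n e y u) = true := by
  intro c hc
  obtain ⟨d, hd, rfl⟩ := List.mem_map.1 hc
  simp only [cmpDefs, List.mem_append] at hd
  rcases hd with (hd | hd) | hd
  · exact eval_of_mem_extAxioms_edefs (sat_C0 (k := k) (e := e) (y := y) (u := u) hP) _ (List.mem_map_of_mem hd)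
  · exact eval_of_mem_extAxioms_edefs (sat_C1 (k := k) (e := e) (y := y) (u := u) hP hn) _ (List.mem_map_of_mem hd)
  · exact eval_of_mem_extAxioms_edefs (sat_CY (k := k) (e := e) (u := u) hP) _ (List.mem_map_of_mem hd)

/-- The gadget's definitions hold. [folklore] -/
theorem eval_orDefs {n e y u : ℕ} : ∀ c ∈ extAxioms ((ORo m P).edefs (orT m) m), c.eval (assign k m P n e y u) = true :=
  eval_of_mem_extAxioms_edefs (sat_ORo (k := k) hP)

include hT hNOKall he1 hmW in
/-- **The certificate `res Z = res Y` holds** (`y^(e·u) ≡ y (mod n)`, `n ≥ 2`). [cite: KrajicekPudlak1998, proof of Thm. 1] -/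
theorem eval_certZ {n e y u : ℕ} (h2 : 2 ≤ n) (hn : n < 2 ^ m) (he : e < 2 ^ m) (hy : y < 2 ^ m) (hu : u < 2 ^ m) (hcong : y ^ (e * u) ≡ y [MOD n]) :
    ∀ c ∈ certZ k m P, c.eval (assign k m P n e y u) = true := by
  intro c hc
  obtain ⟨i, hi, rfl⟩ := List.mem_map.1 hc
  rw [List.mem_range] at hi
  have hW : 0 < W := by have := pos_of_two_le h2 hn; omega
  have hNOK := hNOKall n (by omega) hn
  have hw : wval (fun i => zG k m n e y u (k.tOff W i)) W = wval (yB k m n y) W := by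
    rw [wval_zG hT hNOK hn hmW hW he1 h2 hy he hu, wval_yB hT hNOK hn hmW hW (by omega) hy]; exact hcong
  have hbit := wval_inj hw i hi
  simp only [eqv, eval_biimp, eval, assign_tZ hP i hi, assign_resY hP i hi, hbit, beq_self_eq_true]

include hT hNOKall he1 hmW in
/-- **The parity literal**: bit `0` of `res X = y^u mod n = x` is the parity of `x`. [cite: KrajicekPudlak1998, proof of Thm. 1] -/
theorem assign_parity {n e y u x : ℕ} (h2 : 2 ≤ n) (hn : n < 2 ^ m) (hy : y < 2 ^ m) (hu : u < 2 ^ m) (hx : x < n) (hcong : y ^ u ≡ x [MOD n]) :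
    assign k m P n e y u (k.t (Xo k m P) W 0) = decide (x % 2 = 1) := by
  have hW : 0 < W := by have := pos_of_two_le h2 hn; omega
  have hNOK := hNOKall n (by omega) hn
  have hw := wval_xG hT hNOK hn hmW hW hy he1 h2 hu
  have hx' : y ^ u % n = x := by rw [hcong, Nat.mod_eq_of_lt hx]
  rw [hx'] at hw
  have hpar := wval_mod_two (fun i => xG k m n y u (k.tOff W i)) hW
  rw [hw] at hpar
  rw [assign_tX hP 0 hW]
  cases hb : xG k m n y u (k.tOff W 0) <;> rw [hb] at hpar <;> simp at hpar ⊢ <;> omega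

omit hP in
/-- The comparison bit of a comparator view. [folklore] -/
theorem ge_eq (V : Sub.View) : V.ge W W = V.base + 3 * W := by
  simp only [Sub.View.ge, Sub.View.adder, Adder.View.c, Adder.View.wire]; ring

include hT hNOKall he1 hmW in
/-- **The constraints of copy `1` hold on `A¹`.** [cite: KrajicekPudlak1998, Thm. 1] -/
theorem sem_T1 {n e y : ℕ} (hmem : (n, e, y) ∈ rsaPair 1) (hn : n < 2 ^ m) (he : e < 2 ^ m) (hy : y < 2 ^ m) :
    ∃ σ : ℕ → Bool, AssignsTriple m n e y σ ∧ ∀ c ∈ T1 k m P, c.eval σ = true := by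
  obtain ⟨u, x, hun, hxn, hpar, hc1, hc2⟩ := exists_witness hmem
  have h2 := two_le_of_mem_one hmem
  have hu : u < 2 ^ m := by omega
  have hW : 0 < W := by have := pos_of_two_le h2 hn; omega
  have hNOK := hNOKall n (by omega) hn
  refine ⟨assign k m P n e y u, assignsTriple n e y u, fun c hc => ?_⟩
  simp only [T1, List.mem_append, List.mem_cons, List.not_mem_nil, or_false] at hc
  rcases hc with (hc | hc) | rfl | rfl | rfl | rfl | rfl
  · rw [extAxioms, List.map_append, List.map_append, List.mem_append, List.mem_append] at hc
    rcases hc with (hc | hc) | hc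
    · exact eval_orDefs hP c hc
    · exact eval_compDefs hP hn c hc
    · exact eval_cmpDefs hP hn c hc
  · exact eval_certZ hT hNOKall he1 hmW hP h2 hn he hy hu hc1 c hc
  · rw [eval, assign_parity hT hNOKall he1 hmW hP h2 hn hy hu hxn hc2, hpar]; rfl
  · rw [eval, assign_ov hP hn, decide_eq_true h2]
  · rw [eval, eval, ge_eq]
    show (!assign k m P n e y u (bC k m P + 3 * W)) = true
    rw [assign_C0 hP (by omega), Sub.wireVal_subT_ge, wval_inp2B_x, wval_inp2B_n, wval_nwB hn hmW, wval_eq_zero fun _ _ => rfl]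
    simp; omega
  · rw [eval, eval, ge_eq]
    show (!assign k m P n e y u (bC k m P + (3 * W + 1) + 3 * W)) = true
    rw [assign_C1 hP (by omega), Sub.wireVal_subT_ge, wval_inp2B_x, wval_inp2B_n, wval_nwB hn hmW, wval_owB hW, decide_eq_true h2]
    simp; omega
  · rw [eval, eval, ge_eq]
    show (!assign k m P n e y u (bC k m P + 2 * (3 * W + 1) + 3 * W)) = true
    rw [assign_CY hP (by omega), Sub.wireVal_subT_ge, wval_inp2B_x, wval_inp2B_n, wval_nwB hn hmW, wval_yB hT hNOK hn hmW hW (by omega) hy]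
    have := Nat.mod_lt y (show 0 < n by omega)
    simp; omega

include hT hNOKall he1 hmW in
/-- **The constraints of copy `0` hold on `A⁰`** (for `n ≤ 1` through the escape literal `¬o`).
[cite: KrajicekPudlak1998, Thm. 1] -/
theorem sem_T0 {n e y : ℕ} (hmem : (n, e, y) ∈ rsaPair 0) (hn : n < 2 ^ m) (he : e < 2 ^ m) (hy : y < 2 ^ m) :
    ∃ σ : ℕ → Bool, AssignsTriple m n e y σ ∧ ∀ c ∈ T0 k m P, c.eval σ = true := by
  obtain ⟨u, x, hun, hxn, hpar, hc1, hc2⟩ := exists_witness hmem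
  have hu : u < 2 ^ m := by omega
  refine ⟨assign k m P n e y u, assignsTriple n e y u, fun c hc => ?_⟩
  simp only [T0, List.mem_append, List.mem_map] at hc
  rcases hc with hc | ⟨c, hc, rfl⟩
  · exact eval_orDefs hP c hc
  · rw [eval, eval, eval, assign_ov hP hn]
    by_cases h2 : 2 ≤ n
    · rw [decide_eq_true h2]
      simp only [Bool.not_true, Bool.or_false]
      simp only [List.mem_singleton] at hc
      rcases hc with (hc | hc) | rfl
      · exact eval_compDefs hP hn c hc
      · exact eval_certZ hT hNOKall he1 hmW hP h2 hn he hy hu hc1 c hc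
      · rw [eval, eval, assign_parity hT hNOKall he1 hmW hP h2 hn hy hu hxn hc2, hpar]; rfl
    · rw [decide_eq_false h2]; simp

end Sem

end RSA

end Literature.Computability.MetaComplexity
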